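/-
Copyright (c) 2026 the pub-hodgecm-mathlib formalisation cell (harness21).  Prover seat hodgecm-mathlib-K2E4-p10 (g6), Track B ∕ K2-LIT, h413 =
`stmt-HodgeConjecture-24833`, line `K2_E1_TraceFormulaBeta`, campaign «EIS-R7-BL-SPH-3», letter (L4) `hreg` «REGULAR REMAINDER» of the capstone₃ skeleton ★ p859307
(`K2E1SphericalEisensteinContinuationCMThreeOfLetters`) — the PAYER SKELETON, hypothesis-first (dealer K2E1-plan (g6) (53)∕(57)(iv), 2026-09-04T10:15:34Z ∕ 10:17:37Z).
-/
import Summits.HodgeConjecture.HodgeConjecture.Theorems.K2E1BLRemovablePolesU                                 -- ★ p859366 (this seat): the removable-singularity bricks and the domination `‖ĥ(z)Ẽ(z)(g)‖ ≤ C₀‖Λ^T Ẽ(z)‖`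
import Summits.HodgeConjecture.HodgeConjecture.Theorems.K2E1SphericalEisensteinContinuationCMThreeOfLetters    -- ★ p859307 (K2E1-p02 g6): the capstone₃ skeleton and the bytes of its letter `hreg`; brings `eisensteinSeriesU`, `flatSectionU`, `borelHeight`
import HarnessLib

/-!
# K2·E1 — `K2E1SphericalEisensteinRegularRemainderCMThreeOfLetters`: the letter (L4) `hreg` «REGULAR REMAINDER» of the `U(2,1)` capstone, PAID FROM NAMED LETTERS —
# removable singularities off the pole `ρ₀ = 2` (★ bricks + the continued Hecke relation + the Maass–Selberg bound on the truncation) and the residue letter at `ρ₀`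

Track B ∕ K2-LIT, crux h413 = `stmt-HodgeConjecture-24833`, route of record `HCCMUnconditional`; cell `hodgecm-mathlib`, squad K2, ENGINE E1, campaign EIS-R7-BL-SPH-3 (R31).  Prover seat
`hodgecm-mathlib-K2E4-p10` (g6); DEAL (53)∕(57)(iv) of the dealer K2E1-plan (g6) («K2E4-p10 = (L4) payer»).  THEOREMS ONLY (no `def`, no `instance`, no notation, no named-fact hypothesis,
no `sorry`); lane `--supports stmt-HodgeConjecture-24833 --as helper` (count-neutral).  Closes no socket.  §1–§3 are pure complex analysis ∕ rank-generic; §4 prints `hreg`'s bytes at `N = 3`.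

THE MATHEMATICS ([MoeglinWaldspurger1995, IV.1.9–IV.1.11, IV.3.12 (b)]; [BernsteinLapid2019, Thm 2.3 and §4 p. 10]; [Langlands1976, §7]).  The capstone ★ p859307 needs, for every `g`,
a function `R_g` HOLOMORPHIC on `{1 < Re z}` with `E(φ₀H^z)(g) = φ₀·(H(g)^z + c̃(z)·H(g)^{2−z}) + R_g(z)` for `Re z > 2` (letter `hreg`).  Write `Ẽ(z)(g)` for the Bernstein–Lapid continued
point values (meromorphic in `z`, holomorphic off a `g`-uniform candidate pole set `P` without accumulation points, ★ (38b)) and `r_g(z) := Ẽ(z)(g) − φ₀·(H(g)^z + c̃(z)·H(g)^{2−z})`.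
Then `r_g` has ONLY REMOVABLE SINGULARITIES on `{1 < Re z}`: (a) off `P ∪ {2}` it is holomorphic ((E1), (L3)); (b) at `z₀ ∈ P`, `z₀ ≠ 2` (where `c̃` is holomorphic) the value `Ẽ(z)(g)` is
BOUNDED near `z₀` — the continued Hecke relation `ĥ(z)·Ẽ(z)(g) = ∫ h(y)·Ẽ(z)(g y) dν_G` only sees `Ẽ(z)` on the compact `g·supp h`, where it coincides with its truncation `Λ^T Ẽ(z)` for `T`
large, so `‖ĥ(z)·Ẽ(z)(g)‖ ≤ C₀·‖Λ^T Ẽ(z)‖_{L²(𝔛)}` (★ `exists_bound_smoothing_truncation_of_isCompact`), and `‖Λ^T Ẽ(z)‖_{L²}` is bounded near `z₀` by the continued Maass–Selberg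
relation (letter `hMS`), `ĥ(z₀) ≠ 0` — hence removable (★ `analyticAt_toMeromorphicNFAt_of_eventually_norm_le`); (c) AT `z₀ = 2` both `Ẽ(·)(g)` and `c̃` have a simple pole and
«`r_g` regular at 2» IS Langlands' «the residue of the Eisenstein series at `2ρ_H` is the constant `φ₀·r`» — carried as the letter `hres` (payer: the `L²` residue argument, where ★ ROAD B
`hmean_cm_threeR` p859288 enters).  A function with only removable singularities has a holomorphic modification agreeing with it at its holomorphic points (§1, `R := lim_{w → z, w ≠ z} r(w)`).
* §1 (any complete `X`) **`exists_analyticOnNhd_modification`** — `∀ z₀ ∈ U, ∃ G, AnalyticAt G z₀ ∧ G = r on 𝓝[≠] z₀` ⟹ `∃ R, AnalyticOnNhd ℂ R U ∧ R = r at the analytic points of r`;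
  `exists_analyticAt_eventuallyEq_of_meromorphicAt_of_eventually_norm_le` (meromorphic + bounded ⟹ such a `G`).
* §2 (rank `N`, `quasiSplit F E c N`) **`eventually_norm_le_of_hecke_truncation`** — the boundedness (b) from the letters (Hk) continued Hecke relation on an eventual set `S ∋ᶠ z`,
  (Tr) invariance ∕ square-integrability of `Λ^T Ẽ(z)`, (hMS) the eventual `L²`-bound of the truncation, for a real `C_c` test function `h` with `ĥ` continuous and `ĥ(z₀) ≠ 0`.
* §3 (abstract index type `A` for `g`, parameters `U, ρ₀, P, height h : A → ℝ_{>0}`) **`exists_regular_remainder_of_letters`** — (a)(b)(c) ⟹ `∀ a, ∃ R, DifferentiableOn ℂ R U ∧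
  ∀ z ∈ U ∖ (P ∪ {ρ₀}), Ẽ z a = φ₀·(h a^z + c̃ z·h a^{ρ₀−z}) + R z`.
* §4 THE CM PRINT (`U(2,1)_{L∕L⁺}`, `U = {1 < re}`, `ρ₀ = 2`, `P ⊆ {re ≤ 2}`, agreement of `Ẽ` with the Godement series on `{2 < re}`): **`hreg_cm_three_of_letters`** — EXACTLY the binder
  `hreg` of ★ `sphericalEisenstein_continuation_cm_three_of_letters`, modulo the letters (E1) `hEmer hEan hEeq`, (P) `hP hP2`, (L3′) `hc`, (B) `hbdd` (= §2's output, per `g` and fake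
  pole), (RES) `hres`.
HONEST LABEL: HC_CM is proved only modulo the 7 printed citations (2 remaining named inputs: hLiu418 = `stmt-HodgeConjecture-24832`, h413 = `stmt-HodgeConjecture-24833`) until rung 0
closes; this file asserts no named fact and closes no socket; its heads are CONDITIONAL on the letters named above (payers: (38b)∕(60) EXPORTS K2E1-p08; MS-3 real-segment bound
K2E4-p11; the residue letter's `L²` argument — next file of this seat).
References: [MoeglinWaldspurger1995] IV.1.9–IV.1.11, IV.3.12 · [BernsteinLapid2019] Thm 2.3, §4 p. 10 · [Langlands1976] §7 · [Garrett2018] §1.12, §11.3.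
-/

set_option autoImplicit false
-- the mandated namespace repeats the single-problem summit's segment (`HodgeConjecture.HodgeConjecture`)
set_option linter.dupNamespace false

noncomputable section

open MeasureTheory Measure NumberField IsDedekindDomain Set Filter Topology
open scoped ENNReal NNReal
open Literature.NumberTheory.Automorphic Literature.NumberTheory.Automorphic.UnitaryGroup AdelicGroupData
open Summit.HodgeConjecture.HodgeConjecture.Cruxes.H413.K2E1BorelEisensteinU
open Summit.HodgeConjecture.HodgeConjecture.Cruxes.H413.K2E1BLRemovablePolesU

namespace Summit.HodgeConjecture.HodgeConjecture.Cruxes.H413.K2E1SphericalEisensteinRegularRemainderCMThreeOfLetters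

/-! ## §1 A function with only removable singularities has a holomorphic modification -/

section Modification

variable {X : Type*} [NormedAddCommGroup X] [NormedSpace ℂ X]

/-- **HOLOMORPHIC MODIFICATION**: if at every point `z₀ ∈ U` some function analytic at `z₀` agrees with `r` on a punctured neighbourhood (i.e. `r` has at worst a removable singularity at
`z₀`), then `R(z) := lim_{w → z, w ≠ z} r(w)` is ANALYTIC on a neighbourhood of every point of `U` and `R = r` at every point of `U` where `r` is analytic. [cite: MoeglinWaldspurger1995, IV.1.9] -/
theorem exists_analyticOnNhd_modification [CompleteSpace X] {r : ℂ → X} {U : Set ℂ} (h : ∀ z₀ ∈ U, ∃ G : ℂ → X, AnalyticAt ℂ G z₀ ∧ G =ᶠ[𝓝[≠] z₀] r) :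
    ∃ R : ℂ → X, AnalyticOnNhd ℂ R U ∧ ∀ z₀ ∈ U, AnalyticAt ℂ r z₀ → R z₀ = r z₀ := by
  refine ⟨fun z => limUnder (𝓝[≠] z) r, fun z₀ hz₀ => ?_, fun z₀ _ hr => hr.continuousAt.continuousWithinAt.tendsto.limUnder_eq⟩
  obtain ⟨G, hG, hGr⟩ := h z₀ hz₀
  -- an open `V ∋ z₀` on which `G` is analytic and `G = r` off `z₀`
  obtain ⟨V, hV, hVo, hz₀V⟩ : ∃ V : Set ℂ, (∀ z ∈ V, AnalyticAt ℂ G z ∧ (z ≠ z₀ → G z = r z)) ∧ IsOpen V ∧ z₀ ∈ V := by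
    have h1 : ∀ᶠ z in 𝓝 z₀, AnalyticAt ℂ G z ∧ (z ≠ z₀ → G z = r z) := hG.eventually_analyticAt.and (eventually_nhdsWithin_iff.1 hGr)
    exact eventually_nhds_iff.1 h1
  -- `R = G` on `V`
  have hRG : ∀ z ∈ V, limUnder (𝓝[≠] z) r = G z := by
    intro z hz
    refine Filter.Tendsto.limUnder_eq ?_
    have hGc : Tendsto G (𝓝[≠] z) (𝓝 (G z)) := (hV z hz).1.continuousAt.continuousWithinAt.tendsto
    refine hGc.congr' ?_
    by_cases hzz : z = z₀
    · subst hzz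
      exact hGr
    · -- near `z ≠ z₀` the points stay in `V` and away from `z₀`
      have hn : ∀ᶠ w in 𝓝[≠] z, w ∈ V ∧ w ≠ z₀ := mem_nhdsWithin_of_mem_nhds ((hVo.inter isOpen_ne).mem_nhds ⟨hz, hzz⟩)
      exact hn.mono fun w hw => (hV w hw.1).2 hw.2
  exact hG.congr (Filter.eventuallyEq_iff_exists_mem.2 ⟨V, hVo.mem_nhds hz₀V, fun z hz => (hRG z hz).symm⟩)

/-- **MEROMORPHIC + BOUNDED ⟹ A REMOVABLE SINGULARITY** in §1's currency: `∃ G`, analytic at `z₀`, `G = r` on `𝓝[≠] z₀` (`G :=` the normal form, ★ `analyticAt_toMeromorphicNFAt_of_eventually_norm_le`).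
[cite: MoeglinWaldspurger1995, IV.1.9] -/
theorem exists_analyticAt_eventuallyEq_of_meromorphicAt_of_eventually_norm_le {r : ℂ → X} {z₀ : ℂ} (hr : MeromorphicAt r z₀) (hb : ∃ C : ℝ, ∀ᶠ z in 𝓝[≠] z₀, ‖r z‖ ≤ C) :
    ∃ G : ℂ → X, AnalyticAt ℂ G z₀ ∧ G =ᶠ[𝓝[≠] z₀] r :=
  ⟨toMeromorphicNFAt r z₀, analyticAt_toMeromorphicNFAt_of_eventually_norm_le hr hb, hr.eq_nhdsNE_toMeromorphicNFAt.symm⟩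

/-- The trivial case: `r` analytic at `z₀`. [folklore] -/
theorem exists_analyticAt_eventuallyEq_of_analyticAt {r : ℂ → X} {z₀ : ℂ} (hr : AnalyticAt ℂ r z₀) : ∃ G : ℂ → X, AnalyticAt ℂ G z₀ ∧ G =ᶠ[𝓝[≠] z₀] r :=
  ⟨r, hr, Filter.EventuallyEq.rfl⟩

end Modification

/-! ## §2 Boundedness near a fake pole from the continued Hecke relation and the Maass–Selberg bound on the truncation (rank `N`) -/

section Hecke

variable {F E : Type} [Field F] [NumberField F] [Field E] [NumberField E] [Algebra F E] {c : E ≃ₐ[F] E} {N : ℕ} [NeZero N]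
  [MeasurableSpace (quasiSplit F E c N).Adelic] [BorelSpace (quasiSplit F E c N).Adelic]
  (μ : Measure (quasiSplit F E c N).automorphicQuotient) [(quasiSplit F E c N).IsAutomorphicMeasure μ]
  (νG : Measure (quasiSplit F E c N).Adelic) [νG.IsHaarMeasure] [νG.IsInvInvariant]

/-- **(B) FROM (Hk)(Tr)(hMS)**: `Ẽ(·)(g)` IS BOUNDED NEAR `z₀`.  Data: a real `h ∈ C_c(G(𝔸))` with spherical transform `ĥ` continuous at `z₀` and `ĥ(z₀) ≠ 0`; an eventual set of
admissible parameters (`∀ᶠ z in 𝓝[≠] z₀, z ∈ S` — e.g. `S = {1 < re} ∖ P`); on `S` the CONTINUED HECKE RELATION `∫ h(y)·Ẽ(z)(g y) dν_G = ĥ(z)·Ẽ(z)(g)` (Hk) and the invariance ∕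
square-integrability of the truncation `Λ^T Ẽ(z)` for `T ≥ T₁` (Tr); and (hMS) for every `T ≥ T₁` an eventual bound of `‖Λ^T Ẽ(z)‖_{L²(μ)}` on `S`.  Then `‖Ẽ(z)(g)‖ ≤ C` near `z₀`
(★ `exists_bound_smoothing_truncation_of_isCompact` on the compact `{g}` with `T := max T₀ T₁`, ★ `eventually_norm_le_of_smul`). [cite: MoeglinWaldspurger1995, IV.3.12] [cite: BernsteinLapid2019, §4 p. 10] -/
theorem eventually_norm_le_of_hecke_truncation (νN : Measure ↥(adelicUnipotent F E c N)) (𝓕 : Set ↥(adelicUnipotent F E c N))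
    {h : (quasiSplit F E c N).Adelic → ℝ} (hh : Continuous h) (hhc : HasCompactSupport h) {hhat : ℂ → ℂ} {z₀ : ℂ} (hhhat : ContinuousAt hhat z₀) (hhhat0 : hhat z₀ ≠ 0)
    (g : (quasiSplit F E c N).Adelic) {Ec : ℂ → (quasiSplit F E c N).Adelic → ℂ} {S : Set ℂ} (hS : ∀ᶠ z in 𝓝[≠] z₀, z ∈ S)
    (hHk : ∀ z ∈ S, ∫ y, ((h y : ℝ) : ℂ) * Ec z (g * y) ∂νG = hhat z * Ec z g) {T₁ : ℝ≥0}
    (hTr : ∀ z ∈ S, ∀ T : ℝ≥0, T₁ ≤ T → (∀ γ ∈ (quasiSplit F E c N).quotientSubgroup, ∀ y, truncation νN 𝓕 T (Ec z) (γ * y) = truncation νN 𝓕 T (Ec z) y) ∧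
      MemLp ((quasiSplit F E c N).quotFun (truncation νN 𝓕 T (Ec z))) 2 μ)
    (hMS : ∀ T : ℝ≥0, T₁ ≤ T → ∃ C : ℝ, ∀ᶠ z in 𝓝[≠] z₀, z ∈ S → (eLpNorm ((quasiSplit F E c N).quotFun (truncation νN 𝓕 T (Ec z))) 2 μ).toReal ≤ C) :
    ∃ C : ℝ, ∀ᶠ z in 𝓝[≠] z₀, ‖Ec z g‖ ≤ C := by
  obtain ⟨C₀, T₀, hC₀⟩ := exists_bound_smoothing_truncation_of_isCompact μ νG νN 𝓕 hh hhc (isCompact_singleton (x := g))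
  set T : ℝ≥0 := max T₀ T₁ with hT
  obtain ⟨C, hC⟩ := hMS T (le_max_right _ _)
  refine eventually_norm_le_of_smul hhhat hhhat0 (B := max C₀ 0 * C) ?_
  filter_upwards [hS, hC] with z hzS hzC
  obtain ⟨hG, h2⟩ := hTr z hzS T (le_max_right _ _)
  have hb := hC₀ T (le_max_left _ _) g (Set.mem_singleton g) (Ec z) hG h2
  rw [hHk z hzS] at hb
  rw [smul_eq_mul]
  calc ‖hhat z * Ec z g‖ ≤ C₀ * (eLpNorm ((quasiSplit F E c N).quotFun (truncation νN 𝓕 T (Ec z))) 2 μ).toReal := hb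
    _ ≤ max C₀ 0 * (eLpNorm ((quasiSplit F E c N).quotFun (truncation νN 𝓕 T (Ec z))) 2 μ).toReal := mul_le_mul_of_nonneg_right (le_max_left _ _) ENNReal.toReal_nonneg
    _ ≤ max C₀ 0 * C := mul_le_mul_of_nonneg_left (hzC hzS) (le_max_right _ _)

end Hecke

/-! ## §3 Assembly over an abstract index: (a) off `P ∪ {ρ₀}` analytic, (b) on `P ∖ {ρ₀}` bounded, (c) at `ρ₀` the residue letter ⟹ a regular remainder -/

section Assembly

/-- **THE REGULAR REMAINDER FROM THE LETTERS** (abstract index type `A` for the group variable; `U` open, pole `ρ₀`, candidate pole set `P`, heights `h a > 0`; `U` any set).  Let `Ec : ℂ → A → ℂ` be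
meromorphic on `U` in `z` for each `a` (E1), analytic at the points of `U ∖ (P ∪ {ρ₀})`; `c̃` analytic on `U ∖ {ρ₀}` (L3′); at each FAKE pole `z₀ ∈ P ∩ U`, `z₀ ≠ ρ₀`, let `Ec(·)(a)` be
BOUNDED near `z₀` (B) (§2); and at `ρ₀` let the remainder `r_a(z) = Ec z a − φ₀·(h a^z + c̃ z·h a^{ρ₀−z})` have a removable singularity (RES).  Then for every `a` there is `R_a` HOLOMORPHIC
on `U` with `Ec z a = φ₀·(h a^z + c̃ z·h a^{ρ₀−z}) + R_a z` at every `z ∈ U ∖ (P ∪ {ρ₀})` (§1 modification of `r_a`; on `P ∖ {ρ₀}` ★ `analyticAt_toMeromorphicNFAt_of_eventually_norm_le`).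
[cite: MoeglinWaldspurger1995, IV.1.9–IV.1.11 and IV.3.12] [cite: BernsteinLapid2019, Thm 2.3] -/
theorem exists_regular_remainder_of_letters {A : Type*} {U P : Set ℂ} {ρ₀ : ℂ} (φ₀ : ℂ) {Ec : ℂ → A → ℂ} {cc : ℂ → ℂ} {h : A → ℝ} (hh : ∀ a, 0 < h a)
    (hEmer : ∀ a, ∀ z₀ ∈ U, MeromorphicAt (fun z => Ec z a) z₀)
    (hEan : ∀ a, ∀ z₀ ∈ U, z₀ ∉ P → z₀ ≠ ρ₀ → AnalyticAt ℂ (fun z => Ec z a) z₀)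
    (hcan : ∀ z₀ ∈ U, z₀ ≠ ρ₀ → AnalyticAt ℂ cc z₀)
    (hbdd : ∀ a, ∀ z₀ ∈ U, z₀ ∈ P → z₀ ≠ ρ₀ → ∃ C : ℝ, ∀ᶠ z in 𝓝[≠] z₀, ‖Ec z a‖ ≤ C)
    (hres : ∀ a, ∃ G : ℂ → ℂ, AnalyticAt ℂ G ρ₀ ∧ G =ᶠ[𝓝[≠] ρ₀] (fun z => Ec z a - φ₀ * (((h a : ℝ) : ℂ) ^ z + cc z * ((h a : ℝ) : ℂ) ^ (ρ₀ - z)))) :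
    ∀ a, ∃ R : ℂ → ℂ, DifferentiableOn ℂ R U ∧
      ∀ z ∈ U, z ∉ P → z ≠ ρ₀ → Ec z a = φ₀ * (((h a : ℝ) : ℂ) ^ z + cc z * ((h a : ℝ) : ℂ) ^ (ρ₀ - z)) + R z := by
  intro a
  -- the constant-term model `m(z) = φ₀·(h^z + c̃ z·h^{ρ₀−z})` is analytic off `ρ₀`
  have hsl : ((h a : ℝ) : ℂ) ∈ Complex.slitPlane := Complex.ofReal_mem_slitPlane.2 (hh a)
  have hman : ∀ z₀ ∈ U, z₀ ≠ ρ₀ → AnalyticAt ℂ (fun z => φ₀ * (((h a : ℝ) : ℂ) ^ z + cc z * ((h a : ℝ) : ℂ) ^ (ρ₀ - z))) z₀ := fun z₀ hz₀ hne =>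
    analyticAt_const.mul ((analyticAt_const.cpow analyticAt_id hsl).add ((hcan z₀ hz₀ hne).mul (analyticAt_const.cpow (analyticAt_const.sub analyticAt_id) hsl)))
  -- every singularity of the remainder is removable
  have hrem : ∀ z₀ ∈ U, ∃ G : ℂ → ℂ, AnalyticAt ℂ G z₀ ∧ G =ᶠ[𝓝[≠] z₀] (fun z => Ec z a - φ₀ * (((h a : ℝ) : ℂ) ^ z + cc z * ((h a : ℝ) : ℂ) ^ (ρ₀ - z))) := by
    intro z₀ hz₀
    by_cases hρ : z₀ = ρ₀
    · subst hρ
      exact hres a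
    by_cases hP : z₀ ∈ P
    · -- a fake pole: meromorphic and bounded
      refine exists_analyticAt_eventuallyEq_of_meromorphicAt_of_eventually_norm_le ((hEmer a z₀ hz₀).sub (hman z₀ hz₀ hρ).meromorphicAt) ?_
      obtain ⟨C, hC⟩ := hbdd a z₀ hz₀ hP hρ
      have hm : ∀ᶠ z in 𝓝 z₀, ‖φ₀ * (((h a : ℝ) : ℂ) ^ z + cc z * ((h a : ℝ) : ℂ) ^ (ρ₀ - z))‖ <
          ‖φ₀ * (((h a : ℝ) : ℂ) ^ z₀ + cc z₀ * ((h a : ℝ) : ℂ) ^ (ρ₀ - z₀))‖ + 1 :=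
        (hman z₀ hz₀ hρ).continuousAt.norm.eventually_mem (Iio_mem_nhds (lt_add_one _))
      refine ⟨C + (‖φ₀ * (((h a : ℝ) : ℂ) ^ z₀ + cc z₀ * ((h a : ℝ) : ℂ) ^ (ρ₀ - z₀))‖ + 1), ?_⟩
      filter_upwards [hC, mem_nhdsWithin_of_mem_nhds hm] with z hz hz'
      exact (norm_sub_le _ _).trans (add_le_add hz hz'.le)
    · exact exists_analyticAt_eventuallyEq_of_analyticAt ((hEan a z₀ hz₀ hP hρ).sub (hman z₀ hz₀ hρ))
  obtain ⟨R, hR, hRr⟩ := exists_analyticOnNhd_modification hrem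
  refine ⟨R, hR.differentiableOn, fun z hz hP hne => ?_⟩
  rw [hRr z hz ((hEan a z hz hP hne).sub (hman z hz hne)), add_sub_cancel]

end Assembly

/-! ## §4 The CM print: the letter `hreg` of the `U(2,1)` capstone ★ p859307, modulo (E1)(L3′)(B)(RES) -/

section CM

variable (L : Type) [Field L] [NumberField L] [IsCMField L]

/-- **`hreg` FOR `U(2,1)_{L∕L⁺}` FROM THE LETTERS** — the EXACT binder of ★ `sphericalEisenstein_continuation_cm_three_of_letters`: `∀ g, ∃ R, DifferentiableOn ℂ R {1 < re} ∧ ∀ z, 2 < z.re →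
E(φ₀H^z)(g) = φ₀·(H(g)^z + c̃(z)·H(g)^{2−z}) + R z`.  LETTERS (payers): (E1) the continued point values `Ec` — meromorphic in `z` on `{1 < re}` for each `g`, analytic off the candidate pole set
`P ⊆ {re ≤ 2}` and off `2`, equal to the Godement series on `{2 < re}` (★ (38b)∕(60) EXPORTS, K2E1-p08; closer₃ ★ p859360); (L3′) `c̃` analytic on `{1 < re} ∖ {2}` (W5₃-B ∕ (L3));
(B) boundedness near the fake poles (§2 `eventually_norm_le_of_hecke_truncation` from the continued Hecke relation and the Maass–Selberg bound `hMSreal`, K2E4-p11's operator road (66)); (RES) the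
remainder has a removable singularity AT `2` — Langlands' «`Res₂ E = φ₀·r` is constant» (payer: the `L²` residue argument with ★ `hmean_cm_threeR` p859288 and ★
`cmCuspidalSubspaceR_orthogonal_eq_topologicalClosure_span_three`). [cite: MoeglinWaldspurger1995, IV.3.12] [cite: Langlands1976, §7] [cite: BernsteinLapid2019, §4 p. 10] -/
theorem hreg_cm_three_of_letters (φ₀ : ℂ) (cc : ℂ → ℂ) (hcan : ∀ z₀ : ℂ, 1 < z₀.re → z₀ ≠ 2 → AnalyticAt ℂ cc z₀)
    (Ec : ℂ → (quasiSplit (↥(maximalRealSubfield L)) L (IsCMField.complexConj L) 3).Adelic → ℂ) (P : Set ℂ) (hP2 : ∀ z ∈ P, z.re ≤ 2)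
    (hEmer : ∀ g, ∀ z₀ : ℂ, 1 < z₀.re → MeromorphicAt (fun z => Ec z g) z₀)
    (hEan : ∀ g, ∀ z₀ : ℂ, 1 < z₀.re → z₀ ∉ P → z₀ ≠ 2 → AnalyticAt ℂ (fun z => Ec z g) z₀)
    (hEeq : ∀ g, ∀ z : ℂ, 2 < z.re → Ec z g = eisensteinSeriesU (flatSectionU (fun _ : (quasiSplit (↥(maximalRealSubfield L)) L (IsCMField.complexConj L) 3).Adelic => φ₀) z) g)
    (hbdd : ∀ g, ∀ z₀ : ℂ, 1 < z₀.re → z₀ ∈ P → z₀ ≠ 2 → ∃ C : ℝ, ∀ᶠ z in 𝓝[≠] z₀, ‖Ec z g‖ ≤ C)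
    (hres : ∀ g, ∃ G : ℂ → ℂ, AnalyticAt ℂ G 2 ∧ G =ᶠ[𝓝[≠] 2] (fun z => Ec z g -
      φ₀ * ((((borelHeight g : ℝ≥0) : ℝ) : ℂ) ^ z + cc z * (((borelHeight g : ℝ≥0) : ℝ) : ℂ) ^ ((2 : ℂ) - z)))) :
    ∀ g : (quasiSplit (↥(maximalRealSubfield L)) L (IsCMField.complexConj L) 3).Adelic, ∃ R : ℂ → ℂ, DifferentiableOn ℂ R {z : ℂ | 1 < z.re} ∧
      ∀ z : ℂ, 2 < z.re → eisensteinSeriesU (flatSectionU (fun _ : (quasiSplit (↥(maximalRealSubfield L)) L (IsCMField.complexConj L) 3).Adelic => φ₀) z) g =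
        φ₀ * ((((borelHeight g : ℝ≥0) : ℝ) : ℂ) ^ z + cc z * (((borelHeight g : ℝ≥0) : ℝ) : ℂ) ^ ((2 : ℂ) - z)) + R z := by
  have hmain := exists_regular_remainder_of_letters (A := (quasiSplit (↥(maximalRealSubfield L)) L (IsCMField.complexConj L) 3).Adelic) (U := {z : ℂ | 1 < z.re}) (P := P) (ρ₀ := 2) φ₀ (Ec := Ec) (cc := cc)
    (h := fun g => ((borelHeight g : ℝ≥0) : ℝ)) (fun g => NNReal.coe_pos.2 (borelHeight_pos g))
    (fun g z₀ hz₀ => hEmer g z₀ hz₀) (fun g z₀ hz₀ hP hne => hEan g z₀ hz₀ hP hne) (fun z₀ hz₀ hne => hcan z₀ hz₀ hne)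
    (fun g z₀ hz₀ hP hne => hbdd g z₀ hz₀ hP hne) hres
  intro g
  obtain ⟨R, hR, hRE⟩ := hmain g
  refine ⟨R, hR, fun z hz => ?_⟩
  have hzU : z ∈ {z : ℂ | 1 < z.re} := by
    show (1 : ℝ) < z.re
    linarith
  have hzP : z ∉ P := fun h => by linarith [hP2 z h]
  have hz2 : z ≠ 2 := by
    rintro rfl
    norm_num at hz
  rw [← hEeq g z hz]
  exact hRE z hzU hzP hz2

end CM

end Summit.HodgeConjecture.HodgeConjecture.Cruxes.H413.K2E1SphericalEisensteinRegularRemainderCMThreeOfLetters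

end
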